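import Summits.AtomisticToContinuum.Crystallization.Theses.IsometryAtoms
import Summits.AtomisticToContinuum.Crystallization.Theorems.LayeredLawsSelectHcp.Negative.DiracLaws
import Summits.AtomisticToContinuum.Crystallization.Theorems.NearFieldConvexity.Negative.LoadBearing

/-!
# Negative knowledge for crux `MinimisingLawsCohesive` (stmt-AtomisticToContinuum-15777), II:
# the rooted comb — point-stationarity is load-bearing

Crux-attack (vetting) unit `rattack-stmt-AtomisticToContinuum-15777`
(`--supports stmt-AtomisticToContinuum-15777`; Part I is `OnePointMixtures.lean`).

`not_cohesive_without_stationarity`: WITHOUT the Mecke / mass-transport identity the crux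
`IsometryAtoms.MinimisingLawsCohesive` is FALSE.  Witness: the Dirac law at the deterministic
rooted "comb" `{0} ∪ {(1 + k/K)·e₀ : k < K}`, `K = 2³⁹` — the root plus `K` collinear points at
distances in `[1, 2)`, each binding the root by at least `|V_LJ(2)| = 127/49152`
(`lennardJones_le_of_mem_Icc`).  It is a `1/K`-hard-core probability law whose (deterministic)
root energy is `≤ −127·2³⁹/98304 ≤ −2³²/12 ≤ e*` — certified against the tree's LOWER bound
`Blocks.neg_le_energyPerParticle` on every periodic energy per particle, the only one available
(`NearFieldConvexity.Negative.LoadBearing.neg_le_eStar`, reused) — and the comb is bounded,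
hence not relatively dense.  This is the many-neighbour "star" that Lennard-Jones STABILITY
forbids on average over the root
(`card_mul_eStar_le`: a point-stationary law prices the comb's teeth too) but that a single rooted
sample may carry; so any proof of the crux must use point-stationarity to spread the energy
budget, not only the energy VALUE.  Dirac-law plumbing (`measurableSet_singleton_count_restrict`,
`ae_dirac_of_mem`, `of_ae_dirac`, `integral_dirac_of_mem`) from
`LayeredLawsSelectHcp.Negative.DiracLaws`.  All `[folklore]`.
-/

noncomputable section

namespace Summit.AtomisticToContinuum.Crystallization.Theorems.MinimisingLawsCohesive.Negative.RootedComb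

open MeasureTheory Set Filter
open scoped ENNReal Topology
open Literature.MathematicalPhysics.StatisticalMechanics Literature.Probability.Process
open Summit.AtomisticToContinuum.Crystallization.Theorems.ChargedEnergyGapNegative (eStar)
open Summit.AtomisticToContinuum.Crystallization.Theorems.LayeredLawsSelectHcp.Negative.DiracLaws
  (measurableSet_singleton_count_restrict ae_dirac_of_mem of_ae_dirac integral_dirac_of_mem)
open Summit.AtomisticToContinuum.Crystallization.Theorems.NearFieldConvexity.Negative.LoadBearing
  (neg_le_eStar)

/-! ## The comb: a deterministic sub-`e*` rooted sample -/

/-- `V_LJ` on `[1, 2]` is at most `V_LJ(2) = −127/49152`: with `u = r⁻⁶ ∈ [1/64, 1]`,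
`V_LJ = (1/12)u² − (1/6)u` is decreasing in `u` on `(0, 1]`. [folklore] -/
theorem lennardJones_le_of_mem_Icc {r : ℝ} (h1 : 1 ≤ r) (h2 : r ≤ 2) :
    lennardJones r ≤ -127 / 49152 := by
  have hr : 0 < r := by linarith
  set u : ℝ := (r⁻¹) ^ 6 with hu
  have hu1 : u ≤ 1 := pow_le_one₀ (inv_nonneg.2 hr.le) (inv_le_one_of_one_le₀ h1)
  have hu2 : 1 / 64 ≤ u := by
    have h : (2 : ℝ)⁻¹ ≤ r⁻¹ := inv_anti₀ hr h2
    calc (1 / 64 : ℝ) = ((2 : ℝ)⁻¹) ^ 6 := by norm_num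
      _ ≤ (r⁻¹) ^ 6 := pow_le_pow_left₀ (by norm_num) h 6
  have hV : lennardJones r = 1 / 12 * u ^ 2 - 1 / 6 * u := by
    rw [lennardJones, hu, ← pow_mul]
  rw [hV]
  nlinarith [mul_nonneg (sub_nonneg.2 hu2) (show (0 : ℝ) ≤ 2 - u - 1 / 64 by linarith)]

/-- **Point-stationarity is load-bearing.** Without the Mecke identity the crux is FALSE: the
Dirac law at the rooted comb `{0} ∪ {(1 + k/K)·e₀ : k < K}`, `K = 2³⁹`, is a `1/K`-hard-core
probability law whose (deterministic) root energy is `≤ −2³²/12 ≤ e*`, and the comb is bounded,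
hence not relatively dense. [folklore] -/
theorem not_cohesive_without_stationarity :
    ¬ (∀ δ : ℝ, 0 < δ → ∀ P : Measure (Measure (EuclideanSpace ℝ (Fin 3))),
        IsProbabilityMeasure P → (∀ᵐ μ ∂P, IsRootedHardCore δ μ) →
        (∫ μ, rootEnergy lennardJones μ ∂P) ≤
          (⨅ Q : PeriodicConfiguration 3, Q.energyPerParticle lennardJones) →
        ∀ᵐ μ ∂P, ∃ R₀ : ℝ, ∀ z : EuclideanSpace ℝ (Fin 3), ∃ y : EuclideanSpace ℝ (Fin 3),
          μ {y} ≠ 0 ∧ dist z y ≤ R₀) := by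
  intro H
  -- the comb
  set K : ℕ := 2 ^ 39 with hK
  have hK0 : (0 : ℝ) < K := by rw [hK]; positivity
  have hK1 : (1 : ℝ) ≤ K := by rw [hK]; exact_mod_cast Nat.one_le_two_pow
  set v : EuclideanSpace ℝ (Fin 3) := EuclideanSpace.single 0 1 with hv
  have hv1 : ‖v‖ = 1 := by rw [hv, PiLp.norm_single, norm_one]
  set f : ℕ → EuclideanSpace ℝ (Fin 3) := fun k => (1 + (k : ℝ) / K) • v with hf
  have hnorm : ∀ k : ℕ, ‖f k‖ = 1 + k / K := fun k => by
    simp only [hf]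
    rw [norm_smul, hv1, mul_one, Real.norm_eq_abs, abs_of_pos (by positivity)]
  have hsub : ∀ a b : ℕ, f a - f b = (((a : ℝ) - b) / K) • v := fun a b => by
    simp only [hf]
    rw [← sub_smul]
    congr 1
    ring
  have hfinj : Function.Injective f := by
    intro a b hab
    have h := hnorm a
    rw [hab, hnorm b, add_right_inj, div_left_inj' hK0.ne'] at h
    exact_mod_cast h.symm
  set T : Finset (EuclideanSpace ℝ (Fin 3)) := Finset.image f (Finset.range K) with hT
  have hmemT : ∀ {y}, y ∈ T → ∃ k, k < K ∧ f k = y := fun hy => by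
    obtain ⟨k, hk, rfl⟩ := Finset.mem_image.1 hy
    exact ⟨k, Finset.mem_range.1 hk, rfl⟩
  have hnormT : ∀ {y}, y ∈ T → 1 ≤ ‖y‖ ∧ ‖y‖ < 2 := fun hy => by
    obtain ⟨k, hk, rfl⟩ := hmemT hy
    rw [hnorm k]
    have hk' : (k : ℝ) < K := by exact_mod_cast hk
    have hlt : (k : ℝ) / K < 1 := (div_lt_one hK0).2 hk'
    exact ⟨by linarith [(by positivity : (0 : ℝ) ≤ k / K)], by linarith⟩
  have h0T : (0 : EuclideanSpace ℝ (Fin 3)) ∉ T := fun h0 => by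
    have h := (hnormT h0).1
    rw [norm_zero] at h
    linarith
  set S : Finset (EuclideanSpace ℝ (Fin 3)) := insert 0 T with hS
  have hnormS : ∀ {y}, y ∈ S → ‖y‖ < 2 := fun hy => by
    rcases Finset.mem_insert.1 hy with rfl | hy
    · rw [norm_zero]; norm_num
    · exact (hnormT hy).2
  set ν : Measure (EuclideanSpace ℝ (Fin 3)) :=
    Measure.count.restrict (↑S : Set (EuclideanSpace ℝ (Fin 3))) with hν
  have hνm : MeasurableSet ({ν} : Set (Measure (EuclideanSpace ℝ (Fin 3)))) :=
    measurableSet_singleton_count_restrict S.finite_toSet.countable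
  -- hard core `1/K`
  have hhc : IsRootedHardCore (1 / (K : ℝ)) ν := by
    refine ⟨↑S, by simp [hS], ?_, rfl⟩
    intro x hx y hy hxy
    rw [Finset.mem_coe, hS, Finset.mem_insert] at hx hy
    have hfar : ∀ {w}, w ∈ T → 1 / (K : ℝ) ≤ ‖w‖ := fun hw =>
      ((div_le_one hK0).2 hK1).trans (hnormT hw).1
    rcases hx with rfl | hx <;> rcases hy with rfl | hy
    · exact absurd rfl hxy
    · rw [dist_zero_left]; exact hfar hy
    · rw [dist_zero_right]; exact hfar hx
    · obtain ⟨a, -, rfl⟩ := hmemT hx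
      obtain ⟨b, -, rfl⟩ := hmemT hy
      have hab : a ≠ b := fun h => hxy (by rw [h])
      rw [dist_eq_norm, hsub, norm_smul, hv1, mul_one, Real.norm_eq_abs, abs_div,
        abs_of_pos hK0]
      gcongr
      rcases lt_or_gt_of_ne hab with h | h
      · have h' : (a : ℝ) + 1 ≤ b := by exact_mod_cast h
        rw [abs_sub_comm, abs_of_pos (by linarith)]; linarith
      · have h' : (b : ℝ) + 1 ≤ a := by exact_mod_cast h
        rw [abs_of_pos (by linarith)]; linarith
  -- the root energy of the comb
  have hE : rootEnergy lennardJones ν ≤ eStar := by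
    rw [hν, rootEnergy_count_restrict_coe_finset, hS, Finset.sum_insert h0T, norm_zero,
      lennardJones_zero, zero_add, hT, Finset.sum_image fun a _ b _ h => hfinj h]
    have hterm : ∀ k ∈ Finset.range K, lennardJones ‖f k‖ ≤ -127 / 49152 := fun k hk => by
      have hb := hnormT (Finset.mem_image_of_mem f hk)
      exact lennardJones_le_of_mem_Icc hb.1 hb.2.le
    have hsum := Finset.sum_le_sum hterm
    rw [Finset.sum_const, Finset.card_range, nsmul_eq_mul] at hsum
    have hKr : (K : ℝ) = 2 ^ 39 := by rw [hK]; norm_num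
    rw [hKr] at hsum
    refine le_trans ?_ neg_le_eStar
    linarith
  -- apply the stationarity-free crux to `δ_ν`
  have hconc := H (1 / (K : ℝ)) (by positivity) (Measure.dirac ν) inferInstance
    (ae_dirac_of_mem hνm hhc) (by rw [integral_dirac_of_mem hνm]; exact hE)
  obtain ⟨R₀, hR⟩ := of_ae_dirac hconc
  obtain ⟨y, hy, hzy⟩ := hR (EuclideanSpace.single 0 (|R₀| + 2))
  have hyS : y ∈ S := by
    rw [← Finset.mem_coe]; exact (count_restrict_singleton_ne_zero_iff _ y).1 hy
  have h1 : ‖(EuclideanSpace.single 0 (|R₀| + 2) : EuclideanSpace ℝ (Fin 3))‖ = |R₀| + 2 := by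
    rw [PiLp.norm_single, Real.norm_eq_abs, abs_of_pos (by positivity)]
  have h2 := norm_sub_norm_le (EuclideanSpace.single 0 (|R₀| + 2) : EuclideanSpace ℝ (Fin 3)) y
  rw [← dist_eq_norm, h1] at h2
  linarith [hnormS hyS, le_abs_self R₀]

end Summit.AtomisticToContinuum.Crystallization.Theorems.MinimisingLawsCohesive.Negative.RootedComb

end
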